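import Summits.HodgeConjecture.CorCM.ReflexSlotIncidence
import HarnessLib

/-!
# The reflex slot of a CM type with THREE conjugate pairs and pair flips: the cube of the eight attached types

COR-CM (cell `pub-hodgecm2`, binder seat `b16` gen 45, count-neutral claim REFLEX-OCTIC-34, file F3); theorems only, no
definition, no named fact, no `sorry`.  Setting of `ReflexSlotIncidence` (a group `G` acting on `Z` and `Y`, a CM type
`Φ₀ ⊆ Z` for the conjugation `ρ`, the reflex slot `T : Y → Set Z`, `T(y₀) = Φ₀`) specialised to THREE conjugate pairs,
`Φ₀ = {x₁, x₂, x₃}`, with PAIR FLIPS `φ₁, φ₂, φ₃ ∈ G` (`φ_i x_i = ρx_i`, `φ_i` trivial off `{x_i, ρx_i}`) — in the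
application `Z = Hom(K_T, ℂ)` for a sextic CM field `K_T` whose Galois closure has degree `24` or `48`
(`(ℤ/2)³ ⋊ C₃` or `(ℤ/2)³ ⋊ 𝔖₃`, Dodson 1984 §5.1.2) and `Y = Hom(K_F, ℂ)` for the REFLEX field `K_F ≅ K*` of
`(K_T, Φ₀)`, an octic field (Reflex Degree Theorem: `[K* : ℚ] = 2³`).  Then `Y` is a CUBE: a point `y` is the vertex
`(x_i ∈ T y)_{i=1,2,3} ∈ {±1}³`, `ρ` is the antipode, `φ_i` reflects the `i`-th coordinate, and the FACE
`{y' : x₁ ∈ T y' ⟺ x₁ ∈ T y}` through `y` is `{y, φ₂y, φ₃y, φ₂φ₃y}`.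

* §1 bookkeeping (`Z = {x_i, ρx_i}`; the flips at all six points; `φ_i` on `x_j`, `ρx_j`; `ρφ₁` acts on `Y` as
  `φ₂φ₃`, `ρφ₁φ₂` as `φ₃`);
* §2 `filter_mem_typeMap_iff_eq` — the face through `y` as a four-element `Finset`, its four points distinct, and the
  FACE SUM `Σ_{face(y)} f = f(y) + f(φ₂y) + f(φ₃y) + f(φ₂φ₃y)`;
* §3 `sum_eq_zero_of_odd`, `sum_filter_not_eq_neg` — an odd weight on `Y` sums to `0`, so the two opposite faces carry
  opposite sums;
* §4 **`sub_add_sub_eq_faceSum_mul_sign`** — the identity behind the rank computation of `PairFlipSexticReflexSlotRank`: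
  for an ODD weight `u` on `Y` (`u(ρy) = −u(y)`),
  `u(y) − u(φ₁y) + u(φ₂y) − u(φ₁φ₂y) = S₁ · sgn₁(y)`, `S₁ = Σ_{y' : x₁ ∈ T y'} u(y')`, `sgn₁(y) = ±1` according as
  `x₁ ∈ T y` or not (`−u(φ₁y) = u(ρφ₁y) = u(φ₂φ₃y)` and `−u(φ₁φ₂y) = u(φ₃y)` turn the left side into the face sum);
* §5 `eq_or_eq_of_cube` — the eight vertices `y₀, φ₂y₀, φ₃y₀, φ₂φ₃y₀` and their antipodes exhaust `Y`, and
  **`card_eq_eight`**: `|Y| = 8` — the reflex field of a CM type on a pair-flip sextic field is OCTIC (Dodson's Reflex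
  Degree Theorem `[K' : ℚ] = 2^v (G₀ : S₀)` with `v = 3`, `S₀ = G₀`).

## References

* [Dodson1984] B. Dodson, *The structure of Galois groups of CM-fields*, Trans. AMS 283 (1984), §1 (Reflex Degree
  Theorem), §3.3.2, §5.1.2, Prop. 5.2.2.
* [Shimura1998] G. Shimura, *Abelian Varieties with Complex Multiplication and Modular Functions*, §8.3 Prop. 28, §8.4.
-/

set_option autoImplicit false

open scoped BigOperators Classical

namespace Summit.HodgeConjecture.CorCM

namespace ReflexSlot

open Literature.NumberTheory.ComplexMultiplication

variable {G : Type*} [Group G] {Z Y : Type*} [MulAction G Z] [MulAction G Y] {ρ : G} {Φ₀ : Set Z}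
  {T : Y → Set Z} {y₀ : Y} {x₁ x₂ x₃ : Z} {φ₁ φ₂ φ₃ : G}

/-! ### §1 Bookkeeping: three conjugate pairs and their flips -/

/-- Two members of a CM type are not conjugate: `x, x' ∈ Φ₀ ⟹ x ≠ ρx'`. [cite: Shimura1998, §8.3 Prop. 28] -/
theorem ne_rho_smul_of_mem (hΦ : IsCMTypeWith ρ Φ₀) {x x' : Z} (hx : x ∈ Φ₀) (hx' : x' ∈ Φ₀) : x ≠ ρ • x' :=
  fun h => (hΦ.mem_iff x').1 hx' (h ▸ hx)

/-- A pair flip at `x` fixes every other member `x'` of the type and its conjugate. [cite: Dodson1984, §5.1] -/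
theorem pairFlip_smul_eq_of_mem (hΦ : IsCMTypeWith ρ Φ₀) {φ : G} {x x' : Z} (hx : x ∈ Φ₀) (hx' : x' ∈ Φ₀)
    (hne : x' ≠ x) (hφ' : ∀ z : Z, z ≠ x → z ≠ ρ • x → φ • z = z) :
    φ • x' = x' ∧ φ • ρ • x' = ρ • x' := by
  refine ⟨hφ' x' hne (ne_rho_smul_of_mem hΦ hx' hx), hφ' _ (fun h => ne_rho_smul_of_mem hΦ hx hx' h.symm) ?_⟩
  intro h
  exact hne (by simpa [hΦ.invol] using congrArg (fun w => ρ • w) h)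

/-- Membership of the three named points in `Φ₀ = {x₁, x₂, x₃}`. [folklore] -/
theorem mem_of_eq_triple (hx : Φ₀ = {x₁, x₂, x₃}) : x₁ ∈ Φ₀ ∧ x₂ ∈ Φ₀ ∧ x₃ ∈ Φ₀ := by
  subst hx
  simp

/-- A property of all members of `Φ₀ = {x₁, x₂, x₃}` from the three instances. [folklore] -/
theorem forall_mem_of_triple (hx : Φ₀ = {x₁, x₂, x₃}) {P : Z → Prop} (h₁ : P x₁) (h₂ : P x₂) (h₃ : P x₃) :
    ∀ x ∈ Φ₀, P x := by
  subst hx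
  intro x hx'
  rcases hx' with rfl | rfl | rfl <;> assumption

/-- **Every point of `Z` is one of `x₁, x₂, x₃, ρx₁, ρx₂, ρx₃`** (`Z = Φ₀ ⊔ ρΦ₀`). [cite: Shimura1998, §8.3 Prop. 28] -/
theorem eq_or_eq_rho_smul_of_triple (hΦ : IsCMTypeWith ρ Φ₀) (hx : Φ₀ = {x₁, x₂, x₃}) (z : Z) :
    (z = x₁ ∨ z = x₂ ∨ z = x₃) ∨ (z = ρ • x₁ ∨ z = ρ • x₂ ∨ z = ρ • x₃) := by
  by_cases hz : z ∈ Φ₀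
  · left
    rw [hx] at hz
    simpa using hz
  · right
    have hρz : ρ • z ∈ Φ₀ := (hΦ.rho_smul_mem_iff z).2 hz
    rw [hx] at hρz
    have hzz : z = ρ • ρ • z := (hΦ.invol z).symm
    simp only [Set.mem_insert_iff, Set.mem_singleton_iff] at hρz
    rcases hρz with h | h | h <;> rw [hzz, h] <;> simp

/-- **Pair flips at all six points** from the three flips `φ₁, φ₂, φ₃` (the flip at `ρx_i` is `φ_i` again): the
`∀∃` form consumed by `CMTypeRankIrreducibleSlot`. [cite: Dodson1984, §5.1] -/
theorem forall_exists_pairFlip_of_triple (hΦ : IsCMTypeWith ρ Φ₀) (hx : Φ₀ = {x₁, x₂, x₃})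
    (hφ₁ : φ₁ • x₁ = ρ • x₁ ∧ ∀ z : Z, z ≠ x₁ → z ≠ ρ • x₁ → φ₁ • z = z)
    (hφ₂ : φ₂ • x₂ = ρ • x₂ ∧ ∀ z : Z, z ≠ x₂ → z ≠ ρ • x₂ → φ₂ • z = z)
    (hφ₃ : φ₃ • x₃ = ρ • x₃ ∧ ∀ z : Z, z ≠ x₃ → z ≠ ρ • x₃ → φ₃ • z = z) (z : Z) :
    ∃ φ : G, φ • z = ρ • z ∧ ∀ w : Z, w ≠ z → w ≠ ρ • z → φ • w = w := by
  -- the flip at `ρx` is the flip at `x`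
  have conj : ∀ {x : Z} {φ : G}, (φ • x = ρ • x ∧ ∀ w : Z, w ≠ x → w ≠ ρ • x → φ • w = w) →
      (φ • ρ • x = ρ • ρ • x ∧ ∀ w : Z, w ≠ ρ • x → w ≠ ρ • ρ • x → φ • w = w) := by
    rintro x φ ⟨h1, h2⟩
    refine ⟨by rw [hΦ.invol, smul_rho_eq_of_pairFlip hΦ h1], fun w hw hw' => h2 w ?_ hw⟩
    rw [hΦ.invol] at hw'; exact hw'
  rcases eq_or_eq_rho_smul_of_triple hΦ hx z with (rfl | rfl | rfl) | (rfl | rfl | rfl)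
  · exact ⟨φ₁, hφ₁⟩
  · exact ⟨φ₂, hφ₂⟩
  · exact ⟨φ₃, hφ₃⟩
  · exact ⟨φ₁, conj hφ₁⟩
  · exact ⟨φ₂, conj hφ₂⟩
  · exact ⟨φ₃, conj hφ₃⟩

/-- **`ρφ₁` acts on `Y` as `φ₂φ₃`** (both flip exactly the pairs of `x₂` and `x₃`). [cite: Dodson1984, §5.1] -/
theorem rho_smul_pairFlip_smul (hΦ : IsCMTypeWith ρ Φ₀)
    (hT : ∀ (g : G) (y : Y) (x : Z), x ∈ T (g • y) ↔ g⁻¹ • x ∈ T y) (hTi : Function.Injective T)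
    (hx : Φ₀ = {x₁, x₂, x₃}) (h12 : x₁ ≠ x₂) (h13 : x₁ ≠ x₃) (h23 : x₂ ≠ x₃)
    (hφ₁ : φ₁ • x₁ = ρ • x₁ ∧ ∀ z : Z, z ≠ x₁ → z ≠ ρ • x₁ → φ₁ • z = z)
    (hφ₂ : φ₂ • x₂ = ρ • x₂ ∧ ∀ z : Z, z ≠ x₂ → z ≠ ρ • x₂ → φ₂ • z = z)
    (hφ₃ : φ₃ • x₃ = ρ • x₃ ∧ ∀ z : Z, z ≠ x₃ → z ≠ ρ • x₃ → φ₃ • z = z) (y : Y) :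
    ρ • φ₁ • y = φ₂ • φ₃ • y := by
  obtain ⟨m₁, m₂, m₃⟩ := mem_of_eq_triple hx
  rw [← mul_smul, ← mul_smul]
  refine smul_eq_smul_of_forall_smul_eq hT hTi (forall_smul_eq_of_forall_mem hΦ
    (forall_mem_of_triple hx ?_ ?_ ?_)) y
  · rw [mul_smul, mul_smul, hφ₁.1, hΦ.invol, (pairFlip_smul_eq_of_mem hΦ m₃ m₁ h13 hφ₃.2).1,
      (pairFlip_smul_eq_of_mem hΦ m₂ m₁ h12 hφ₂.2).1]
  · rw [mul_smul, mul_smul, (pairFlip_smul_eq_of_mem hΦ m₁ m₂ h12.symm hφ₁.2).1,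
      (pairFlip_smul_eq_of_mem hΦ m₃ m₂ h23 hφ₃.2).1, hφ₂.1]
  · rw [mul_smul, mul_smul, (pairFlip_smul_eq_of_mem hΦ m₁ m₃ h13.symm hφ₁.2).1, hφ₃.1,
      (pairFlip_smul_eq_of_mem hΦ m₂ m₃ h23.symm hφ₂.2).2]

/-- **`ρφ₁φ₂` acts on `Y` as `φ₃`**. [cite: Dodson1984, §5.1] -/
theorem rho_smul_pairFlip_smul_pairFlip_smul (hΦ : IsCMTypeWith ρ Φ₀)
    (hT : ∀ (g : G) (y : Y) (x : Z), x ∈ T (g • y) ↔ g⁻¹ • x ∈ T y) (hTi : Function.Injective T)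
    (hx : Φ₀ = {x₁, x₂, x₃}) (h12 : x₁ ≠ x₂) (h13 : x₁ ≠ x₃) (h23 : x₂ ≠ x₃)
    (hφ₁ : φ₁ • x₁ = ρ • x₁ ∧ ∀ z : Z, z ≠ x₁ → z ≠ ρ • x₁ → φ₁ • z = z)
    (hφ₂ : φ₂ • x₂ = ρ • x₂ ∧ ∀ z : Z, z ≠ x₂ → z ≠ ρ • x₂ → φ₂ • z = z)
    (hφ₃ : φ₃ • x₃ = ρ • x₃ ∧ ∀ z : Z, z ≠ x₃ → z ≠ ρ • x₃ → φ₃ • z = z) (y : Y) :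
    ρ • φ₁ • φ₂ • y = φ₃ • y := by
  obtain ⟨m₁, m₂, m₃⟩ := mem_of_eq_triple hx
  rw [← mul_smul, ← mul_smul]
  refine smul_eq_smul_of_forall_smul_eq hT hTi (forall_smul_eq_of_forall_mem hΦ
    (forall_mem_of_triple hx ?_ ?_ ?_)) y
  · rw [mul_smul, mul_smul, (pairFlip_smul_eq_of_mem hΦ m₂ m₁ h12 hφ₂.2).1, hφ₁.1, hΦ.invol,
      (pairFlip_smul_eq_of_mem hΦ m₃ m₁ h13 hφ₃.2).1]
  · rw [mul_smul, mul_smul, hφ₂.1, (pairFlip_smul_eq_of_mem hΦ m₁ m₂ h12.symm hφ₁.2).2, hΦ.invol,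
      (pairFlip_smul_eq_of_mem hΦ m₃ m₂ h23 hφ₃.2).1]
  · rw [mul_smul, mul_smul, (pairFlip_smul_eq_of_mem hΦ m₂ m₃ h23.symm hφ₂.2).1,
      (pairFlip_smul_eq_of_mem hΦ m₁ m₃ h13.symm hφ₁.2).1, hφ₃.1]

/-- Coordinates of `φ₂y`: `x₁`- and `x₃`-coordinates unchanged, `x₂`-coordinate reflected. [cite: Dodson1984, §5.1] -/
theorem mem_typeMap_pairFlip_smul (hΦ : IsCMTypeWith ρ Φ₀)
    (hT : ∀ (g : G) (y : Y) (x : Z), x ∈ T (g • y) ↔ g⁻¹ • x ∈ T y) (hT₀ : T y₀ = Φ₀)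
    (hY : ∀ y : Y, ∃ g : G, g • y₀ = y) (hx : Φ₀ = {x₁, x₂, x₃}) (h12 : x₁ ≠ x₂) (h23 : x₂ ≠ x₃)
    (hφ₂ : φ₂ • x₂ = ρ • x₂ ∧ ∀ z : Z, z ≠ x₂ → z ≠ ρ • x₂ → φ₂ • z = z) (y : Y) :
    (x₁ ∈ T (φ₂ • y) ↔ x₁ ∈ T y) ∧ (x₂ ∈ T (φ₂ • y) ↔ x₂ ∉ T y) ∧ (x₃ ∈ T (φ₂ • y) ↔ x₃ ∈ T y) := by
  obtain ⟨m₁, m₂, m₃⟩ := mem_of_eq_triple hx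
  exact ⟨mem_typeMap_smul_iff_of_smul_eq hT (pairFlip_smul_eq_of_mem hΦ m₂ m₁ h12 hφ₂.2).1 y,
    mem_typeMap_smul_iff_of_smul_rho_eq hΦ hT hT₀ hY (smul_rho_eq_of_pairFlip hΦ hφ₂.1) y,
    mem_typeMap_smul_iff_of_smul_eq hT (pairFlip_smul_eq_of_mem hΦ m₂ m₃ h23.symm hφ₂.2).1 y⟩

/-! ### §2 The face through a point -/

section Face

variable [Fintype Y]

/-- **The face through `y`**: the points with the same `x₁`-coordinate as `y` are `y, φ₂y, φ₃y, φ₂φ₃y`.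
[cite: Dodson1984, §5.1] -/
theorem filter_mem_typeMap_iff_eq (hΦ : IsCMTypeWith ρ Φ₀)
    (hT : ∀ (g : G) (y : Y) (x : Z), x ∈ T (g • y) ↔ g⁻¹ • x ∈ T y) (hTi : Function.Injective T)
    (hT₀ : T y₀ = Φ₀) (hY : ∀ y : Y, ∃ g : G, g • y₀ = y) (hx : Φ₀ = {x₁, x₂, x₃}) (h12 : x₁ ≠ x₂)
    (h13 : x₁ ≠ x₃) (h23 : x₂ ≠ x₃)
    (hφ₂ : φ₂ • x₂ = ρ • x₂ ∧ ∀ z : Z, z ≠ x₂ → z ≠ ρ • x₂ → φ₂ • z = z)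
    (hφ₃ : φ₃ • x₃ = ρ • x₃ ∧ ∀ z : Z, z ≠ x₃ → z ≠ ρ • x₃ → φ₃ • z = z) (y : Y) :
    (Finset.univ.filter fun y' => (x₁ ∈ T y' ↔ x₁ ∈ T y)) = {y, φ₂ • y, φ₃ • y, φ₂ • φ₃ • y} := by
  have c₂ := mem_typeMap_pairFlip_smul hΦ hT hT₀ hY hx h12 h23 hφ₂
  have hx' : Φ₀ = {x₁, x₃, x₂} := by rw [hx, Set.pair_comm x₂ x₃]
  have c₃ := mem_typeMap_pairFlip_smul hΦ hT hT₀ hY hx' h13 h23.symm hφ₃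
  ext y'
  simp only [Finset.mem_filter, Finset.mem_univ, true_and, Finset.mem_insert, Finset.mem_singleton]
  constructor
  · intro h1
    -- compare the `x₂`- and `x₃`-coordinates of `y'` with those of `y`
    by_cases h2 : (x₂ ∈ T y' ↔ x₂ ∈ T y) <;> by_cases h3 : (x₃ ∈ T y' ↔ x₃ ∈ T y)
    · exact Or.inl (eq_of_forall_mem_typeMap_iff hΦ hT hTi hT₀ hY (forall_mem_of_triple hx h1 h2 h3))
    · refine Or.inr (Or.inr (Or.inl (eq_of_forall_mem_typeMap_iff hΦ hT hTi hT₀ hY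
        (forall_mem_of_triple hx ?_ ?_ ?_))))
      · rw [(c₃ y).1]; exact h1
      · rw [(c₃ y).2.2]; exact h2
      · rw [(c₃ y).2.1]; tauto
    · refine Or.inr (Or.inl (eq_of_forall_mem_typeMap_iff hΦ hT hTi hT₀ hY (forall_mem_of_triple hx ?_ ?_ ?_)))
      · rw [(c₂ y).1]; exact h1
      · rw [(c₂ y).2.1]; tauto
      · rw [(c₂ y).2.2]; exact h3
    · refine Or.inr (Or.inr (Or.inr (eq_of_forall_mem_typeMap_iff hΦ hT hTi hT₀ hY
        (forall_mem_of_triple hx ?_ ?_ ?_))))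
      · rw [(c₂ _).1, (c₃ y).1]; exact h1
      · rw [(c₂ _).2.1, (c₃ y).2.2]; tauto
      · rw [(c₂ _).2.2, (c₃ y).2.1]; tauto
  · rintro (rfl | rfl | rfl | rfl)
    · exact Iff.rfl
    · exact (c₂ y).1
    · exact (c₃ y).1
    · rw [(c₂ _).1, (c₃ y).1]

omit [Fintype Y] in
/-- The four points of a face are pairwise distinct. [cite: Dodson1984, §5.1] -/
theorem face_points_ne (hΦ : IsCMTypeWith ρ Φ₀)
    (hT : ∀ (g : G) (y : Y) (x : Z), x ∈ T (g • y) ↔ g⁻¹ • x ∈ T y)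
    (hT₀ : T y₀ = Φ₀) (hY : ∀ y : Y, ∃ g : G, g • y₀ = y) (hx : Φ₀ = {x₁, x₂, x₃}) (h12 : x₁ ≠ x₂)
    (h13 : x₁ ≠ x₃) (h23 : x₂ ≠ x₃)
    (hφ₂ : φ₂ • x₂ = ρ • x₂ ∧ ∀ z : Z, z ≠ x₂ → z ≠ ρ • x₂ → φ₂ • z = z)
    (hφ₃ : φ₃ • x₃ = ρ • x₃ ∧ ∀ z : Z, z ≠ x₃ → z ≠ ρ • x₃ → φ₃ • z = z) (y : Y) :
    y ≠ φ₂ • y ∧ y ≠ φ₃ • y ∧ y ≠ φ₂ • φ₃ • y ∧ φ₂ • y ≠ φ₃ • y ∧ φ₂ • y ≠ φ₂ • φ₃ • y ∧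
      φ₃ • y ≠ φ₂ • φ₃ • y := by
  have c₂ := mem_typeMap_pairFlip_smul hΦ hT hT₀ hY hx h12 h23 hφ₂
  have hx' : Φ₀ = {x₁, x₃, x₂} := by rw [hx, Set.pair_comm x₂ x₃]
  have c₃ := mem_typeMap_pairFlip_smul hΦ hT hT₀ hY hx' h13 h23.symm hφ₃
  refine ⟨fun h => ?_, fun h => ?_, fun h => ?_, fun h => ?_, fun h => ?_, fun h => ?_⟩
  · have h1 := (c₂ y).2.1; rw [← h] at h1; exact iff_not_self h1
  · have h1 := (c₃ y).2.1; rw [← h] at h1; exact iff_not_self h1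
  · have h1 := (c₂ (φ₃ • y)).2.1; rw [← h, (c₃ y).2.2] at h1; exact iff_not_self h1
  · have h1 := (c₂ y).2.1; rw [h, (c₃ y).2.2] at h1; exact iff_not_self h1
  · have h1 := (c₂ (φ₃ • y)).2.2; rw [← h, (c₂ y).2.2, (c₃ y).2.1] at h1; exact iff_not_self h1
  · have h1 := (c₂ (φ₃ • y)).2.1; rw [← h] at h1; exact iff_not_self h1

/-- **Face sum**: `Σ_{y' : (x₁ ∈ T y') ⟺ (x₁ ∈ T y)} f(y') = f(y) + f(φ₂y) + f(φ₃y) + f(φ₂φ₃y)`.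
[cite: Dodson1984, §5.1] -/
theorem sum_filter_mem_typeMap_iff (hΦ : IsCMTypeWith ρ Φ₀)
    (hT : ∀ (g : G) (y : Y) (x : Z), x ∈ T (g • y) ↔ g⁻¹ • x ∈ T y) (hTi : Function.Injective T)
    (hT₀ : T y₀ = Φ₀) (hY : ∀ y : Y, ∃ g : G, g • y₀ = y) (hx : Φ₀ = {x₁, x₂, x₃}) (h12 : x₁ ≠ x₂)
    (h13 : x₁ ≠ x₃) (h23 : x₂ ≠ x₃)
    (hφ₂ : φ₂ • x₂ = ρ • x₂ ∧ ∀ z : Z, z ≠ x₂ → z ≠ ρ • x₂ → φ₂ • z = z)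
    (hφ₃ : φ₃ • x₃ = ρ • x₃ ∧ ∀ z : Z, z ≠ x₃ → z ≠ ρ • x₃ → φ₃ • z = z) (f : Y → ℚ) (y : Y) :
    ∑ y' ∈ Finset.univ.filter (fun y' => (x₁ ∈ T y' ↔ x₁ ∈ T y)), f y' =
      f y + f (φ₂ • y) + f (φ₃ • y) + f (φ₂ • φ₃ • y) := by
  obtain ⟨n₁, n₂, n₃, n₄, n₅, n₆⟩ := face_points_ne hΦ hT hT₀ hY hx h12 h13 h23 hφ₂ hφ₃ y
  rw [filter_mem_typeMap_iff_eq hΦ hT hTi hT₀ hY hx h12 h13 h23 hφ₂ hφ₃ y,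
    Finset.sum_insert (by simp [n₁, n₂, n₃]), Finset.sum_insert (by simp [n₄, n₅]),
    Finset.sum_pair n₆]
  ring

/-! ### §3 Odd weights on `Y` -/

/-- **An odd weight on `Y` has total mass `0`** (`ρ` is a fixed-point-free involution of `Y`).
[cite: Shimura1998, §32.10 (proof)] -/
theorem sum_eq_zero_of_odd {u : Y → ℚ} (hu : ∀ y, u (ρ • y) = -u y) : ∑ y, u y = 0 := by
  have h1 : ∑ y, u y = ∑ y, u (ρ • y) := (Fintype.sum_equiv (MulAction.toPerm ρ) _ _ fun y => rfl).symm
  have h2 : ∑ y, u (ρ • y) = -∑ y, u y := by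
    rw [← Finset.sum_neg_distrib]; exact Finset.sum_congr rfl fun y _ => hu y
  linarith

/-- Opposite faces carry opposite sums of an odd weight. [cite: Shimura1998, §32.10 (proof)] -/
theorem sum_filter_not_eq_neg {u : Y → ℚ} (h0 : ∑ y, u y = 0) (P : Y → Prop) :
    ∑ y ∈ Finset.univ.filter (fun y => ¬P y), u y = -∑ y ∈ Finset.univ.filter P, u y := by
  have h := Finset.sum_filter_add_sum_filter_not Finset.univ P u
  linarith

/-! ### §4 The key identity -/

/-- **`u(y) − u(φ₁y) + u(φ₂y) − u(φ₁φ₂y) = S₁ · sgn₁(y)`** for an odd weight `u` on the cube, where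
`S₁ = Σ_{y' : x₁ ∈ T y'} u(y')` is the sum over the face `x₁ ∈ T(·)` and `sgn₁(y) = ±1` is the `x₁`-coordinate of
`y`: the left side is the sum of `u` over the face through `y` (`−u(φ₁y) = u(φ₂φ₃y)`, `−u(φ₁φ₂y) = u(φ₃y)`).
[cite: Dodson1984, §5.1 and Prop. 5.2.2] -/
theorem sub_add_sub_eq_faceSum_mul_sign (hΦ : IsCMTypeWith ρ Φ₀)
    (hT : ∀ (g : G) (y : Y) (x : Z), x ∈ T (g • y) ↔ g⁻¹ • x ∈ T y) (hTi : Function.Injective T)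
    (hT₀ : T y₀ = Φ₀) (hY : ∀ y : Y, ∃ g : G, g • y₀ = y) (hx : Φ₀ = {x₁, x₂, x₃}) (h12 : x₁ ≠ x₂)
    (h13 : x₁ ≠ x₃) (h23 : x₂ ≠ x₃)
    (hφ₁ : φ₁ • x₁ = ρ • x₁ ∧ ∀ z : Z, z ≠ x₁ → z ≠ ρ • x₁ → φ₁ • z = z)
    (hφ₂ : φ₂ • x₂ = ρ • x₂ ∧ ∀ z : Z, z ≠ x₂ → z ≠ ρ • x₂ → φ₂ • z = z)
    (hφ₃ : φ₃ • x₃ = ρ • x₃ ∧ ∀ z : Z, z ≠ x₃ → z ≠ ρ • x₃ → φ₃ • z = z)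
    {u : Y → ℚ} (hu : ∀ y, u (ρ • y) = -u y) (y : Y) :
    u y - u (φ₁ • y) + u (φ₂ • y) - u ((φ₁ * φ₂) • y) =
      (∑ y' ∈ Finset.univ.filter (fun y' => x₁ ∈ T y'), u y') * (if x₁ ∈ T y then 1 else -1) := by
  -- the left side is the sum over the face through `y`
  have e₁ : u (φ₁ • y) = -u (φ₂ • φ₃ • y) := by
    rw [← rho_smul_pairFlip_smul hΦ hT hTi hx h12 h13 h23 hφ₁ hφ₂ hφ₃ y, hu, neg_neg]
  have e₂ : u ((φ₁ * φ₂) • y) = -u (φ₃ • y) := by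
    rw [mul_smul, ← rho_smul_pairFlip_smul_pairFlip_smul hΦ hT hTi hx h12 h13 h23 hφ₁ hφ₂ hφ₃ y, hu, neg_neg]
  have hface := sum_filter_mem_typeMap_iff hΦ hT hTi hT₀ hY hx h12 h13 h23 hφ₂ hφ₃ u y
  have hlhs : u y - u (φ₁ • y) + u (φ₂ • y) - u ((φ₁ * φ₂) • y) =
      ∑ y' ∈ Finset.univ.filter (fun y' => (x₁ ∈ T y' ↔ x₁ ∈ T y)), u y' := by
    rw [hface, e₁, e₂]; ring
  rw [hlhs]
  by_cases hy : x₁ ∈ T y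
  · rw [if_pos hy, mul_one]
    exact Finset.sum_congr (Finset.filter_congr fun y' _ => by simp [hy]) fun _ _ => rfl
  · rw [if_neg hy, mul_neg, mul_one, ← sum_filter_not_eq_neg (sum_eq_zero_of_odd hu)]
    exact Finset.sum_congr (Finset.filter_congr fun y' _ => by simp [hy]) fun _ _ => rfl

/-! ### §5 The eight vertices -/

/-- **The eight vertices exhaust `Y`**: every point is one of `y₀, φ₂y₀, φ₃y₀, φ₂φ₃y₀` (the face `x₁ ∈ T(·)`) or of
their antipodes. [cite: Dodson1984, §1 (Reflex Degree Theorem)] -/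
theorem eq_or_eq_of_cube (hΦ : IsCMTypeWith ρ Φ₀)
    (hT : ∀ (g : G) (y : Y) (x : Z), x ∈ T (g • y) ↔ g⁻¹ • x ∈ T y) (hTi : Function.Injective T)
    (hT₀ : T y₀ = Φ₀) (hY : ∀ y : Y, ∃ g : G, g • y₀ = y) (hx : Φ₀ = {x₁, x₂, x₃}) (h12 : x₁ ≠ x₂)
    (h13 : x₁ ≠ x₃) (h23 : x₂ ≠ x₃)
    (hφ₂ : φ₂ • x₂ = ρ • x₂ ∧ ∀ z : Z, z ≠ x₂ → z ≠ ρ • x₂ → φ₂ • z = z)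
    (hφ₃ : φ₃ • x₃ = ρ • x₃ ∧ ∀ z : Z, z ≠ x₃ → z ≠ ρ • x₃ → φ₃ • z = z) (y : Y) :
    (y = y₀ ∨ y = φ₂ • y₀ ∨ y = φ₃ • y₀ ∨ y = φ₂ • φ₃ • y₀) ∨
      (y = ρ • y₀ ∨ y = ρ • φ₂ • y₀ ∨ y = ρ • φ₃ • y₀ ∨ y = ρ • φ₂ • φ₃ • y₀) := by
  have m₁ : x₁ ∈ T y₀ := by rw [hT₀]; exact (mem_of_eq_triple hx).1
  by_cases hy : x₁ ∈ T y
  · left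
    have hmem : y ∈ Finset.univ.filter (fun y' => (x₁ ∈ T y' ↔ x₁ ∈ T y₀)) := by simp [hy, m₁]
    rw [filter_mem_typeMap_iff_eq hΦ hT hTi hT₀ hY hx h12 h13 h23 hφ₂ hφ₃ y₀] at hmem
    simpa using hmem
  · right
    have hρ : x₁ ∈ T (ρ • y) := by rw [mem_typeMap_rho_smul_iff hΦ hT hT₀ hY]; exact hy
    have hmem : ρ • y ∈ Finset.univ.filter (fun y' => (x₁ ∈ T y' ↔ x₁ ∈ T y₀)) := by simp [hρ, m₁]
    rw [filter_mem_typeMap_iff_eq hΦ hT hTi hT₀ hY hx h12 h13 h23 hφ₂ hφ₃ y₀] at hmem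
    have hyy : y = ρ • ρ • y := (rho_smul_rho_smul hΦ hT hTi y).symm
    simp only [Finset.mem_insert, Finset.mem_singleton] at hmem
    rcases hmem with h | h | h | h <;> rw [hyy, h] <;> simp

/-- **`|Y| = 8`: the reflex field of a CM type on a sextic CM field with pair flips is OCTIC** (the coordinate map
`Y → {±1}³` is a bijection).  Dodson's Reflex Degree Theorem with `v = 3`, `S₀ = G₀`.
[cite: Dodson1984, §1 (Reflex Degree Theorem)] -/
theorem card_eq_eight (hΦ : IsCMTypeWith ρ Φ₀)
    (hT : ∀ (g : G) (y : Y) (x : Z), x ∈ T (g • y) ↔ g⁻¹ • x ∈ T y) (hTi : Function.Injective T)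
    (hT₀ : T y₀ = Φ₀) (hY : ∀ y : Y, ∃ g : G, g • y₀ = y) (hx : Φ₀ = {x₁, x₂, x₃}) (h12 : x₁ ≠ x₂)
    (h13 : x₁ ≠ x₃) (h23 : x₂ ≠ x₃)
    (hφ₂ : φ₂ • x₂ = ρ • x₂ ∧ ∀ z : Z, z ≠ x₂ → z ≠ ρ • x₂ → φ₂ • z = z)
    (hφ₃ : φ₃ • x₃ = ρ • x₃ ∧ ∀ z : Z, z ≠ x₃ → z ≠ ρ • x₃ → φ₃ • z = z) : Fintype.card Y = 8 := by
  -- the face `x₁ ∈ T(·)` has four points, its complement is its image under `ρ`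
  have m₁ : x₁ ∈ T y₀ := by rw [hT₀]; exact (mem_of_eq_triple hx).1
  obtain ⟨n₁, n₂, n₃, n₄, n₅, n₆⟩ := face_points_ne hΦ hT hT₀ hY hx h12 h13 h23 hφ₂ hφ₃ y₀
  have hF : (Finset.univ.filter fun y' => x₁ ∈ T y').card = 4 := by
    have h1 : (Finset.univ.filter fun y' => x₁ ∈ T y') =
        Finset.univ.filter (fun y' => (x₁ ∈ T y' ↔ x₁ ∈ T y₀)) :=
      Finset.filter_congr fun y' _ => by simp [m₁]
    rw [h1, filter_mem_typeMap_iff_eq hΦ hT hTi hT₀ hY hx h12 h13 h23 hφ₂ hφ₃ y₀,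
      Finset.card_insert_of_notMem (by simp [n₁, n₂, n₃]), Finset.card_insert_of_notMem (by simp [n₄, n₅]),
      Finset.card_pair n₆]
  have hF' : (Finset.univ.filter fun y' => ¬ x₁ ∈ T y').card = 4 := by
    have h1 : (Finset.univ.filter fun y' => ¬ x₁ ∈ T y') =
        (Finset.univ.filter fun y' => x₁ ∈ T y').image (fun y' => ρ • y') := by
      ext y'
      simp only [Finset.mem_filter, Finset.mem_univ, true_and, Finset.mem_image]
      constructor
      · intro hy'
        refine ⟨ρ • y', ?_, rho_smul_rho_smul hΦ hT hTi y'⟩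
        rw [mem_typeMap_rho_smul_iff hΦ hT hT₀ hY]; exact hy'
      · rintro ⟨w, hw, rfl⟩
        rw [mem_typeMap_rho_smul_iff hΦ hT hT₀ hY]; exact not_not.2 hw
    rw [h1, Finset.card_image_of_injective _ (MulAction.injective ρ), hF]
  have h := Finset.card_filter_add_card_filter_not (s := (Finset.univ : Finset Y)) (fun y' => x₁ ∈ T y')
  rw [hF, hF', Finset.card_univ] at h
  omega

end Face

end ReflexSlot

end Summit.HodgeConjecture.CorCM
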